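import Mathlib.Tactic
import HarnessLib

/-!
# Kozma–Nitzan's Question 8 at three relays — the Q-SPLIT of a two-level pair (abstract, finite)

Support file (`--supports stmt-CriticalPhenomena-4575`, closed crux; independent mathematics on Kozma–Nitzan's Question 8,
arXiv:2401.12397 §5.5 p. 36), prover `prim-ineq-gen-6` (gen 23).  No definitions, no named facts, no sorries; standard axioms.
Memo `run/shared/lean/prim/prim-ineq-gen-6/PROOF-QSPLIT-G23.md` §2 (LEMMA Q).
A two-level pair `(M¹ ; M⁰)` of weights on a finite preorder `β` is *good* when `Σ_{U₁} M¹ + Σ_{U₀} M⁰ ≥ 0` for all up-sets `U₀ ⊆ U₁`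
(the C3 corner of the `κ = 2` one-block coefficient has this shape, `…KnQuestion8ThreeChain`).  LEMMA Q of the memo splits the pair by a
*crossing weight* `Q ≥ 0` (the level-1 money converted to level-0 use): if the ONE-LEVEL weights `M¹ − Q` and `M⁰ + Q` are each nonnegative on
every up-set, the pair is good (`pair_of_oneLevel_split`).  The level-1 half `M¹ − Q` is discharged in the memo by an *ancestor transport*:
a nonnegative combination of differences `K(parent c) − K(c)` of kernels ordered on up-sets is nonnegative on up-sets
(`upperSum_nonneg_of_dominated_pairs`, from the closure lemma `upperSum_nonneg_combination`).
[cite: KozmaNitzan2024, Question 8 (§5.5 p. 36)]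
-/

namespace Summit.CriticalPhenomena.PercolationContinuityZ3.Theorems

namespace PocketCert

open Finset

variable {β : Type*} [Preorder β]

/-- **Q-split.**  If `Q ≥ 0` pointwise and both one-level weights `M¹ − Q` and `M⁰ + Q` have nonnegative sums on every up-set, then the
two-level pair `(M¹ ; M⁰)` is good: `Σ_{U₁} M¹ + Σ_{U₀} M⁰ ≥ 0` for all up-sets `U₀ ⊆ U₁` — because
`Σ_{U₁} M¹ + Σ_{U₀} M⁰ = Σ_{U₁}(M¹−Q) + Σ_{U₀}(M⁰+Q) + (Σ_{U₁} Q − Σ_{U₀} Q)`. [cite: KozmaNitzan2024, Question 8 (§5.5 p. 36)] -/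
theorem pair_of_oneLevel_split (M1 M0 Q : β → ℝ) (hQ : ∀ b, 0 ≤ Q b)
    (h1 : ∀ U : Finset β, IsUpperSet (U : Set β) → 0 ≤ ∑ b ∈ U, (M1 b - Q b))
    (h0 : ∀ U : Finset β, IsUpperSet (U : Set β) → 0 ≤ ∑ b ∈ U, (M0 b + Q b))
    (U1 U0 : Finset β) (hU1 : IsUpperSet (U1 : Set β)) (hU0 : IsUpperSet (U0 : Set β)) (hsub : U0 ⊆ U1) :
    0 ≤ ∑ b ∈ U1, M1 b + ∑ b ∈ U0, M0 b := by
  have a1 := h1 U1 hU1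
  have a0 := h0 U0 hU0
  have hC : ∑ b ∈ U0, Q b ≤ ∑ b ∈ U1, Q b :=
    Finset.sum_le_sum_of_subset_of_nonneg hsub fun b _ _ => hQ b
  rw [Finset.sum_sub_distrib] at a1
  rw [Finset.sum_add_distrib] at a0
  linarith

omit [Preorder β] in
/-- **Q-split, converse bookkeeping.**  The two one-level weights of a Q-split sum to the one-level sum of the pair:
`(M¹ − Q) + (M⁰ + Q) = M¹ + M⁰` on every set (so a Q-split of a zero-mass pair consists of two zero-mass weights iff
`Σ Q = Σ M¹`). [cite: KozmaNitzan2024, Question 8 (§5.5 p. 36)] -/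
theorem oneLevel_split_sum (M1 M0 Q : β → ℝ) (U : Finset β) :
    ∑ b ∈ U, (M1 b - Q b) + ∑ b ∈ U, (M0 b + Q b) = ∑ b ∈ U, (M1 b + M0 b) := by
  rw [← Finset.sum_add_distrib]
  exact Finset.sum_congr rfl fun b _ => by ring

/-- **Closure under nonnegative combinations.**  If each weight `f i` (`i` in a finite index set) has nonnegative sums on every up-set and
`a i ≥ 0`, then so does `b ↦ Σ_i a i · f i b`. [cite: KozmaNitzan2024, Question 8 (§5.5 p. 36)] -/
theorem upperSum_nonneg_combination {ι : Type*} (s : Finset ι) (a : ι → ℝ) (f : ι → β → ℝ)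
    (ha : ∀ i ∈ s, 0 ≤ a i)
    (hf : ∀ i ∈ s, ∀ U : Finset β, IsUpperSet (U : Set β) → 0 ≤ ∑ b ∈ U, f i b)
    (U : Finset β) (hU : IsUpperSet (U : Set β)) :
    0 ≤ ∑ b ∈ U, ∑ i ∈ s, a i * f i b := by
  rw [Finset.sum_comm]
  refine Finset.sum_nonneg fun i hi => ?_
  rw [← Finset.mul_sum]
  exact mul_nonneg (ha i hi) (hf i hi U hU)

/-- **Ancestor transport.**  Let `K c` (`c` in a finite index set of "configurations") be weights on `β` and `par c` the parent
configuration, with `K c` dominated by `K (par c)` on up-sets (`Σ_U K c ≤ Σ_U K (par c)`; in the memo: root growth, `K₁(child) ≼ K₁(parent)`).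
Then for nonnegative amounts `a c` the weight `b ↦ Σ_c a c · (K (par c) b − K c b)` is nonnegative on every up-set.  With `a` = the level-1
needs of the cascade this is `Ψ¹ − Q ≽ 0` of LEMMA Q (given that the top configuration needs nothing). [cite: KozmaNitzan2024, Question 8 (§5.5 p. 36)] -/
theorem upperSum_nonneg_of_dominated_pairs {ι : Type*} (s : Finset ι) (a : ι → ℝ) (K : ι → β → ℝ) (par : ι → ι)
    (ha : ∀ c ∈ s, 0 ≤ a c)
    (hdom : ∀ c ∈ s, ∀ U : Finset β, IsUpperSet (U : Set β) → ∑ b ∈ U, K c b ≤ ∑ b ∈ U, K (par c) b)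
    (U : Finset β) (hU : IsUpperSet (U : Set β)) :
    0 ≤ ∑ b ∈ U, ∑ c ∈ s, a c * (K (par c) b - K c b) := by
  refine upperSum_nonneg_combination s a (fun c b => K (par c) b - K c b) ha ?_ U hU
  intro c hc V hV
  rw [Finset.sum_sub_distrib]
  linarith [hdom c hc V hV]


/-- **Fold exactness, nonnegative top.**  If the level-1 weight `M¹` is pointwise nonnegative, the two-level pair `(M¹ ; M⁰)` is good
iff the one-level sum `M¹ + M⁰` has nonnegative sums on every up-set (the binding upper up-set is `U₁ = U₀`).  In the memo (§4, CLAIM 2,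
regime `c > 0`): `𝔄 ≥ 0`, so `M^T ≽ 0 ⟺ fold(M^T) ≽ 0`. [cite: KozmaNitzan2024, Question 8 (§5.5 p. 36)] -/
theorem pair_iff_sum_of_top_nonneg (M1 M0 : β → ℝ) (h1 : ∀ b, 0 ≤ M1 b) :
    (∀ U1 U0 : Finset β, IsUpperSet (U1 : Set β) → IsUpperSet (U0 : Set β) → U0 ⊆ U1 →
        0 ≤ ∑ b ∈ U1, M1 b + ∑ b ∈ U0, M0 b) ↔
      (∀ U : Finset β, IsUpperSet (U : Set β) → 0 ≤ ∑ b ∈ U, (M1 b + M0 b)) := by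
  constructor
  · intro h U hU
    rw [Finset.sum_add_distrib]
    exact h U U hU hU (subset_refl U)
  · intro h U1 U0 hU1 hU0 hsub
    have h0 := h U0 hU0
    rw [Finset.sum_add_distrib] at h0
    have hC : ∑ b ∈ U0, M1 b ≤ ∑ b ∈ U1, M1 b :=
      Finset.sum_le_sum_of_subset_of_nonneg hsub fun b _ _ => h1 b
    linarith

/-- **Fold exactness, nonpositive bottom.**  If the level-0 weight `M⁰` is pointwise nonpositive, the two-level pair `(M¹ ; M⁰)` is good
iff the one-level sum `M¹ + M⁰` has nonnegative sums on every up-set (the binding lower up-set is `U₀ = U₁`).  In the memo (§4, CLAIM 2,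
regime `c ≤ 0`): `𝔅 ≤ 0` by `W_in ≥ 0`. [cite: KozmaNitzan2024, Question 8 (§5.5 p. 36)] -/
theorem pair_iff_sum_of_bottom_nonpos (M1 M0 : β → ℝ) (h0 : ∀ b, M0 b ≤ 0) :
    (∀ U1 U0 : Finset β, IsUpperSet (U1 : Set β) → IsUpperSet (U0 : Set β) → U0 ⊆ U1 →
        0 ≤ ∑ b ∈ U1, M1 b + ∑ b ∈ U0, M0 b) ↔
      (∀ U : Finset β, IsUpperSet (U : Set β) → 0 ≤ ∑ b ∈ U, (M1 b + M0 b)) := by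
  constructor
  · intro h U hU
    rw [Finset.sum_add_distrib]
    exact h U U hU hU (subset_refl U)
  · intro h U1 U0 hU1 hU0 hsub
    have hA := h U1 hU1
    rw [Finset.sum_add_distrib] at hA
    have hC : ∑ b ∈ U1, M0 b ≤ ∑ b ∈ U0, M0 b := by
      have : ∑ b ∈ U0, (-M0 b) ≤ ∑ b ∈ U1, (-M0 b) :=
        Finset.sum_le_sum_of_subset_of_nonneg hsub fun b _ _ => by linarith [h0 b]
      rw [Finset.sum_neg_distrib, Finset.sum_neg_distrib] at this
      linarith
    linarith

end PocketCert

end Summit.CriticalPhenomena.PercolationContinuityZ3.Theorems
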